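import Mathlib
import Summits.KontsevichZagierPeriods.Zeta5Search.LaiKappa3Terms
import Summits.KontsevichZagierPeriods.Zeta5Search.LaiCellRateLB
import HarnessLib

/-!
# Sharded κ₃ cell certificates: from per-shard `decide`s to the five fields of a cell certificate

Sub-problem `KontsevichZagierPeriods/Zeta5Search`, family `fam-indep` (linear independence /
dimension), generation 5. Systematic search; no irrationality claim unless certified.

`LaiKappa3Cells.lean` reduces 'κ₃ ≤ 73' (at generation 5 a manuscript-level candidate; since CERTIFIED by
the data-free order-cell sweep `LaiSweepEngine … LaiKappa3SweepCert`, theorem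
`Sweep.kappa3_sweep_three_le_oddZetaSpanRank`, which SUPERSEDES the stored-table shard protocol of this
file — no shard file of the format below was ever filed) to ONE finite object `Kappa3CellCert` = a cell
table `T` with `wf`, `disj`, `adm`,
`lo : 38700 ≤ cellRateTrunc T K`, `hi : cellRateUB T ≤ 80000`. A realistic table has ≈ 10⁵ cells and
must live in many tree files. This file is the SHARD PROTOCOL:
* `Kappa3Shard` = a list of cells with their sorted-threshold y-partitions (`LaiSavingScan.QPt`);
  `Kappa3Shard.check` = the ONE per-shard Boolean (every cell `WF 434` and `checkAdmS laiTerms74`, and the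
  shard chains: `cellChain`), decided in the shard's own file by `decide +kernel`;
* `CertShard K D` = a shard bundled with `check = true` and two kernel-decided naturals
  `L ≤ cellRateLBNat S.T K D`, `cellRateUBNat S.T D ≤ U` (`LaiCellRateLB.lean`);
* for a list `L : List (CertShard K D)`: `CertShard.cells L` (concatenation), `seams L` (consecutive
  shards chain: `last.v ≤ head.u`, non-empty shards), `sumLow`, `sumUp`, and the FIVE FIELD THEOREMS
  `wf_cells`, `adm_cells`, `disj_cells (seams)`, `lo_cells (38700·D ≤ sumLow)`, `hi_cells (sumUp ≤ 80000·D)`.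
The eventual capstone is then the one-liner (in a file importing `LaiKappa3Cells` and the shard files)
`⟨CertShard.cells L, K, wf_cells L, disj_cells L (by decide), adm_cells L, lo_cells L hD (by decide),
hi_cells L hD (by decide)⟩ : Kappa3CellCert` — whose remaining `decide`s touch only the shard seams and
two sums of naturals. SHARD FILE TEMPLATE (one per ≈ 300 cells):
`def shardNNN : Kappa3Shard := ⟨[(⟨u, v, c⟩, [⟨p, d⟩, …]), …]⟩`,
`theorem shardNNN_check : shardNNN.check = true := by decide +kernel`,
`def csNNN : CertShard 300 (2^40) := ⟨shardNNN, L, U, shardNNN_check, by decide +kernel, by decide +kernel⟩`.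

HONEST FRAMING: bookkeeping over lists; no cell table is exhibited here, no claim about `ζ(5)` or about
'κ₃ ≤ 73' is made. References: [Lai2024BallRivoal] arXiv:2407.14236, §4 (Lemma 4.3), §5;
[Zudilin2004] §8.
-/

namespace Summit.KontsevichZagierPeriods.Zeta5Search

open SavingScan

/-! ### Shards and their one Boolean -/

/-- A shard of a κ₃ cell table: cells `[u, v)` with exponent `c`, each with the y-partition of its
sorted-threshold certificate. [cite: Lai2024BallRivoal, §4 Lemma 4.3] -/
structure Kappa3Shard where
  /-- the cells with their certificate partitions -/
  cells : List (SavingCell × List QPt)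

namespace Kappa3Shard

/-- The cells of a shard. [folklore] -/
def T (S : Kappa3Shard) : List SavingCell := S.cells.map Prod.fst

/-- The per-shard check: every cell is well-formed for `λ = 434` and passes the sorted-threshold
admissibility check against the literal κ₃ term list, and consecutive cells chain. [folklore] -/
def check (S : Kappa3Shard) : Bool :=
  (S.cells.all fun Cy => Cy.1.WF 434 && Cy.1.checkAdmS laiTerms74 Cy.2) && cellChain S.T

/-- A checked shard has well-formed cells. [folklore] -/
theorem wf_of_check (S : Kappa3Shard) (h : S.check = true) : ∀ C ∈ S.T, C.WF 434 = true := by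
  intro C hC
  simp only [check, Bool.and_eq_true, List.all_eq_true] at h
  obtain ⟨Cy, hCy, rfl⟩ := List.mem_map.1 hC
  exact (h.1 Cy hCy).1

/-- A checked shard has admissible cells at the κ₃ point. [cite: Lai2024BallRivoal, §4 Lemma 4.3] -/
theorem adm_of_check (S : Kappa3Shard) (h : S.check = true) :
    ∀ C ∈ S.T, C.Adm 74 2180 444 δ74 5 := by
  intro C hC
  simp only [check, Bool.and_eq_true, List.all_eq_true] at h
  obtain ⟨Cy, hCy, rfl⟩ := List.mem_map.1 hC
  exact SavingCell.adm74_of_checkAdmS Cy.1 Cy.2 (h.1 Cy hCy).2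

/-- A checked shard chains. [folklore] -/
theorem chain_of_check (S : Kappa3Shard) (h : S.check = true) : cellChain S.T = true := by
  simp only [check, Bool.and_eq_true] at h
  exact h.2

end Kappa3Shard

/-! ### Certified shards and their concatenation -/

/-- A certified shard: the data, its decided check, and two decided naturals bracketing its rate
contributions (`L ≤ ⌊D·⌋-minorant of the truncated rate`, `⌈D·⌉-majorant of the upper rate ≤ U`).
[folklore] -/
structure CertShard (K D : ℕ) where
  /-- the shard -/
  S : Kappa3Shard
  /-- certified lower numerator of `D · cellRateTrunc S.T K` -/
  L : ℕ
  /-- certified upper numerator of `D · cellRateUB S.T` -/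
  U : ℕ
  /-- the shard's Boolean check holds -/
  check : S.check = true
  /-- `L` is below the natural-number minorant -/
  lb : L ≤ cellRateLBNat S.T K D
  /-- `U` is above the natural-number majorant -/
  ub : cellRateUBNat S.T D ≤ U

namespace CertShard

variable {K D : ℕ}

/-- The concatenated cell table of a list of certified shards. [folklore] -/
def cells : List (CertShard K D) → List SavingCell
  | [] => []
  | A :: rest => A.S.T ++ cells rest

/-- Sum of the certified lower numerators. [folklore] -/
def sumLow (Ls : List (CertShard K D)) : ℕ := (Ls.map fun A => A.L).sum

/-- Sum of the certified upper numerators. [folklore] -/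
def sumUp (Ls : List (CertShard K D)) : ℕ := (Ls.map fun A => A.U).sum

/-- The seam between two consecutive shards: both non-empty and `last.v ≤ head.u`. [folklore] -/
def seamOK (A B : CertShard K D) : Bool :=
  match A.S.T.getLast?, B.S.T.head? with
  | some C, some C' => decide (C.v ≤ C'.u)
  | _, _ => false

/-- All seams of a list of shards hold. [folklore] -/
def seams : List (CertShard K D) → Bool
  | [] => true
  | [_] => true
  | A :: B :: rest => seamOK A B && seams (B :: rest)

/-- **Field `wf`.** [folklore] -/
theorem wf_cells : ∀ (Ls : List (CertShard K D)), ∀ C ∈ cells Ls, C.WF 434 = true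
  | [], C, hC => by simp [cells] at hC
  | A :: rest, C, hC => by
      rcases List.mem_append.1 hC with h | h
      · exact A.S.wf_of_check A.check C h
      · exact wf_cells rest C h

/-- **Field `adm`.** [cite: Lai2024BallRivoal, §4 Lemma 4.3] -/
theorem adm_cells : ∀ (Ls : List (CertShard K D)), ∀ C ∈ cells Ls, C.Adm 74 2180 444 δ74 5
  | [], C, hC => by simp [cells] at hC
  | A :: rest, C, hC => by
      rcases List.mem_append.1 hC with h | h
      · exact A.S.adm_of_check A.check C h
      · exact adm_cells rest C h

/-- The natural-number minorant of the concatenation is the sum over shards, hence `≥ sumLow`.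
[folklore] -/
theorem sumLow_le_cellRateLBNat : ∀ (Ls : List (CertShard K D)), sumLow Ls ≤ cellRateLBNat (cells Ls) K D
  | [] => by simp [sumLow, cells, cellRateLBNat]
  | A :: rest => by
      have ih := sumLow_le_cellRateLBNat rest
      simp only [sumLow, List.map_cons, List.sum_cons, cells, cellRateLBNat_append] at ih ⊢
      have := A.lb
      omega

/-- The natural-number majorant of the concatenation is the sum over shards, hence `≤ sumUp`.
[folklore] -/
theorem cellRateUBNat_le_sumUp : ∀ (Ls : List (CertShard K D)), cellRateUBNat (cells Ls) D ≤ sumUp Ls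
  | [] => by simp [sumUp, cells, cellRateUBNat]
  | A :: rest => by
      have ih := cellRateUBNat_le_sumUp rest
      simp only [sumUp, List.map_cons, List.sum_cons, cells, cellRateUBNat_append] at ih ⊢
      have := A.ub
      omega

/-- **Field `lo`**: `38700 · D ≤ sumLow ⟹ 38700 ≤ cellRateTrunc (cells Ls) K`. [folklore] -/
theorem lo_cells (Ls : List (CertShard K D)) (hD : 0 < D) (h : 38700 * D ≤ sumLow Ls) :
    (38700 : ℚ) ≤ cellRateTrunc (cells Ls) K := by
  have := le_cellRateTrunc_of_LBNat (cells Ls) (lam := 434) (by norm_num) (wf_cells Ls) K D 38700 hD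
    (h.trans (sumLow_le_cellRateLBNat Ls))
  exact_mod_cast this

/-- **Field `hi`**: `sumUp ≤ 80000 · D ⟹ cellRateUB (cells Ls) ≤ 80000`. [folklore] -/
theorem hi_cells (Ls : List (CertShard K D)) (hD : 0 < D) (h : sumUp Ls ≤ 80000 * D) :
    cellRateUB (cells Ls) ≤ 80000 := by
  have := cellRateUB_le_of_UBNat (cells Ls) (lam := 434) (by norm_num) (wf_cells Ls) D 80000 hD
    ((cellRateUBNat_le_sumUp Ls).trans h)
  exact_mod_cast this

/-- A good seam exposes the head of the next shard. [folklore] -/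
theorem seamOK_spec (A B : CertShard K D) (h : seamOK A B = true) :
    ∃ C C', A.S.T.getLast? = some C ∧ B.S.T.head? = some C' ∧ C.v ≤ C'.u := by
  unfold seamOK at h
  cases hA : A.S.T.getLast? with
  | none => simp [hA] at h
  | some C =>
    cases hB : B.S.T.head? with
    | none => simp [hA, hB] at h
    | some C' =>
      simp only [hA, hB, decide_eq_true_eq] at h
      exact ⟨C, C', rfl, rfl, h⟩

/-- The head of a concatenation whose first shard is non-empty. [folklore] -/
theorem head?_cells_cons (B : CertShard K D) (rest : List (CertShard K D)) {C' : SavingCell}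
    (hB : B.S.T.head? = some C') : (cells (B :: rest)).head? = some C' := by
  simp only [cells]
  cases hT : B.S.T with
  | nil => simp [hT] at hB
  | cons C₀ T' =>
    simp only [hT, List.head?_cons, Option.some.injEq] at hB
    simp [hB]

/-- The concatenation of checked shards with good seams chains. [folklore] -/
theorem chain_cells : ∀ (Ls : List (CertShard K D)), seams Ls = true → cellChain (cells Ls) = true
  | [], _ => rfl
  | [A], _ => by
      simp only [cells, List.append_nil]
      exact A.S.chain_of_check A.check
  | A :: B :: rest, h => by
      simp only [seams, Bool.and_eq_true] at h
      have ih := chain_cells (B :: rest) h.2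
      obtain ⟨C, C', hA, hB, hle⟩ := seamOK_spec A B h.1
      have hhead := head?_cells_cons B rest hB
      show cellChain (A.S.T ++ cells (B :: rest)) = true
      refine cellChain_append A.S.T (cells (B :: rest)) (A.S.chain_of_check A.check) ih ?_
      intro E hE F hF
      rw [hA] at hE
      rw [hhead] at hF
      simp only [Option.mem_def, Option.some.injEq] at hE hF
      subst hE; subst hF
      exact hle

/-- **Field `disj`**: checked shards with good seams give a pairwise disjoint table. [folklore] -/
theorem disj_cells (Ls : List (CertShard K D)) (h : seams Ls = true) : CellsDisjoint (cells Ls) :=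
  cellsDisjoint_of_cellChain (cells Ls) (lam := 434) (chain_cells Ls h) (wf_cells Ls)

/-- **Field `disj`, global variant**: if the whole concatenation is decided to chain (one `decide` over
the seams and cells), the table is pairwise disjoint. [folklore] -/
theorem disj_cells_of_chain (Ls : List (CertShard K D)) (h : cellChain (cells Ls) = true) :
    CellsDisjoint (cells Ls) :=
  cellsDisjoint_of_cellChain (cells Ls) (lam := 434) h (wf_cells Ls)

end CertShard

/-! ### Sanity check: a two-shard toy (two genuine floor-constant cells near x = 3/10 from the
`LaiSavingScan` timing set, one per shard; `K = D = 1`, so the rate numerals are meaningless — the toy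
exercises `check`, `seams` and the field theorems, nothing else) -/

/-- Toy shard A: the cell `[3/10, 130/433)` with exponent 1335 and its 8-piece partition. -/
def toyShardA : Kappa3Shard :=
  ⟨[(⟨(3 : ℚ) / 10, (130 : ℚ) / 433, 1335⟩,
     [⟨1, 5⟩, ⟨2, 5⟩, ⟨1, 2⟩, ⟨3, 5⟩, ⟨7, 10⟩, ⟨4, 5⟩, ⟨9, 10⟩, ⟨1, 1⟩])]⟩

/-- Toy shard B: the next cell `[130/433, 127/423)` with exponent 1341 and its 7-piece partition. -/
def toyShardB : Kappa3Shard :=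
  ⟨[(⟨(130 : ℚ) / 433, (127 : ℚ) / 423, 1341⟩,
     [⟨45, 433⟩, ⟨131, 433⟩, ⟨217, 433⟩, ⟨265, 433⟩, ⟨304, 433⟩, ⟨351, 433⟩, ⟨1, 1⟩])]⟩

/-- Toy shard A passes its check (kernel decision, ≈ 1 s). -/
theorem toyShardA_check : toyShardA.check = true := by decide +kernel

/-- Toy shard B passes its check (kernel decision, ≈ 1 s). -/
theorem toyShardB_check : toyShardB.check = true := by decide +kernel

/-- An over-weighted variant of toy shard A (exponent 5000) is REJECTED by the check. -/
example : (⟨[(⟨(3 : ℚ) / 10, (130 : ℚ) / 433, 5000⟩, [⟨1, 1⟩])]⟩ : Kappa3Shard).check = false := by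
  decide +kernel

/-- Toy certified shard A (`K = D = 1`). -/
def toyCertA : CertShard 1 1 := ⟨toyShardA, 0, 2000, toyShardA_check, by decide +kernel, by decide +kernel⟩

/-- Toy certified shard B (`K = D = 1`). -/
def toyCertB : CertShard 1 1 := ⟨toyShardB, 0, 2000, toyShardB_check, by decide +kernel, by decide +kernel⟩

/-- The two toy shards have a good seam (`130/433 ≤ 130/433`). -/
example : CertShard.seams [toyCertA, toyCertB] = true := by decide +kernel

/-- Hence their concatenation is a pairwise disjoint, well-formed, admissible two-cell table. -/
example : CellsDisjoint (CertShard.cells [toyCertA, toyCertB]) ∧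
    (∀ C ∈ CertShard.cells [toyCertA, toyCertB], C.WF 434 = true) ∧
    (∀ C ∈ CertShard.cells [toyCertA, toyCertB], C.Adm 74 2180 444 δ74 5) :=
  ⟨CertShard.disj_cells _ (by decide +kernel), CertShard.wf_cells _, CertShard.adm_cells _⟩

end Summit.KontsevichZagierPeriods.Zeta5Search
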